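import Summits.NavierStokesRegularity.NavierStokesRegularity.Theorems.CircuitPump.Negative.WitnessStructure

/-!
# `PerpetualPump.CircuitPump` (stmt-NavierStokesRegularity-1834), line `singular-clock-gspt`,
# stub `stub_clockBox` — the instance: the m = 2 SEEDED GRADED TODA TABLE is a legal Tao circuit

The lead's instance of `stub_clockBox` is the two-species circuit (species `0` = carrier `a`,
species `1` = bond `v`; scale `n ∈ ℤ`; `lam > 1`, seed `ε`):

  `ȧ_n = −lam^{4n/5} a_n − lamⁿ v_n² + lam^{n−1} v_{n−1}² − ε lamⁿ a_n v_n`,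
  `v̇_n = −lam^{4n/5} v_n + lamⁿ v_n (a_n − a_{n+1}) + ε lamⁿ a_n²`

(card `Cruxes/CircuitPump/Ideas/graded-toda-soliton-pump.md` with the carrier sign flipped so that the
pump carrier is positive; the coupling constant `c` is scaled to `1`). Its structure constants in the
crux encoding (`Fin 2 → Fin 2 → Fin 2 → Option (Fin 3) → ℝ`) are the table written out EXPLICITLY in
the statements below (no `def`): same-scale bond `(1,1,0,none) = −1`, `(1,0,1,none) = (0,1,1,none) = ½`;
cross-scale bond `(1,1,0,e₃) = 1`, `(1,0,1,e₂) = (0,1,1,e₁) = −½`; seed `(0,0,1,none) = ε`,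
`(0,1,0,none) = (1,0,0,none) = −ε/2`; all other entries `0`.

Proved here (pure algebra, kernel-checked):
* `toda_isSym`  — Tao's symmetry (4.2) (`Theorems.CircuitPumpNegative.IsSym`);
* `toda_isCyc`  — cyclic cancellation (4.3) (`Theorems.CircuitPumpNegative.IsCyc`), i.e. the quadratic
  part conserves `Σ (a_n² + v_n²)`;
* `toda_rhsF_zero`, `toda_rhsF_one` — the crux right-hand side `rhsF` of this table IS the displayed
  Toda system (so every analytic lemma of the line can be stated on the explicit equations).
[folklore]
-/

set_option linter.dupNamespace false

noncomputable section

open scoped BigOperators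
open Finset

namespace Summit.NavierStokesRegularity.NavierStokesRegularity.Theorems.PerpetualPumpCircuitPump

open Summit.NavierStokesRegularity.NavierStokesRegularity.Theorems.CircuitPumpNegative

/-- Every element of `Fin 2` is `0` or `1`. -/
theorem fin_two_eq_zero_or_one (x : Fin 2) : x = 0 ∨ x = 1 := by
  fin_cases x <;> simp

/-- **The seeded graded Toda table obeys Tao's symmetry (4.2).** -/
theorem toda_isSym :
    ∀ (ε : ℝ),
      Summit.NavierStokesRegularity.NavierStokesRegularity.Theorems.CircuitPumpNegative.IsSym (fun
      (i₁ i₂ i₃ : Fin 2) (μ : Option (Fin 3)) => if μ = none then (if i₁ = 1 ∧ i₂ = 1 ∧ i₃ = 0 then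
      (-1 : ℝ) else if i₁ = 1 ∧ i₂ = 0 ∧ i₃ = 1 then 1 / 2 else if i₁ = 0 ∧ i₂ = 1 ∧ i₃ = 1 then 1
      / 2 else if i₁ = 0 ∧ i₂ = 0 ∧ i₃ = 1 then ε else if i₁ = 0 ∧ i₂ = 1 ∧ i₃ = 0 then -ε / 2 else
      if i₁ = 1 ∧ i₂ = 0 ∧ i₃ = 0 then -ε / 2 else 0) else if μ = some 2 then (if i₁ = 1 ∧ i₂ = 1 ∧
      i₃ = 0 then 1 else 0) else if μ = some 1 then (if i₁ = 1 ∧ i₂ = 0 ∧ i₃ = 1 then -1 / 2 else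
      0) else (if i₁ = 0 ∧ i₂ = 1 ∧ i₃ = 1 then -1 / 2 else 0)) := by
  intro ε i₁ i₂ i₃ μ
  rcases fin_two_eq_zero_or_one i₁ with h₁ | h₁ <;>
  rcases fin_two_eq_zero_or_one i₂ with h₂ | h₂ <;>
  rcases fin_two_eq_zero_or_one i₃ with h₃ | h₃ <;>
  subst h₁ <;> subst h₂ <;> subst h₃ <;>
  rcases μ with _ | j <;> (try fin_cases j) <;>
  simp [Equiv.swap_apply_of_ne_of_ne, Equiv.swap_apply_left, Equiv.swap_apply_right]

/-- **The seeded graded Toda table is cyclic-cancelling (4.3)** (energy conservation of the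
quadratic part). -/
theorem toda_isCyc :
    ∀ (ε : ℝ),
      Summit.NavierStokesRegularity.NavierStokesRegularity.Theorems.CircuitPumpNegative.IsCyc (fun
      (i₁ i₂ i₃ : Fin 2) (μ : Option (Fin 3)) => if μ = none then (if i₁ = 1 ∧ i₂ = 1 ∧ i₃ = 0 then
      (-1 : ℝ) else if i₁ = 1 ∧ i₂ = 0 ∧ i₃ = 1 then 1 / 2 else if i₁ = 0 ∧ i₂ = 1 ∧ i₃ = 1 then 1
      / 2 else if i₁ = 0 ∧ i₂ = 0 ∧ i₃ = 1 then ε else if i₁ = 0 ∧ i₂ = 1 ∧ i₃ = 0 then -ε / 2 else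
      if i₁ = 1 ∧ i₂ = 0 ∧ i₃ = 0 then -ε / 2 else 0) else if μ = some 2 then (if i₁ = 1 ∧ i₂ = 1 ∧
      i₃ = 0 then 1 else 0) else if μ = some 1 then (if i₁ = 1 ∧ i₂ = 0 ∧ i₃ = 1 then -1 / 2 else
      0) else (if i₁ = 0 ∧ i₂ = 1 ∧ i₃ = 1 then -1 / 2 else 0)) := by
  intro ε v μ
  have hc1 : (Equiv.swap (0 : Fin 3) 1 * Equiv.swap 1 2).symm = Equiv.swap 1 2 * Equiv.swap 0 1 := by
    decide
  have hc2 : (Equiv.swap (1 : Fin 3) 2 * Equiv.swap 0 1).symm = Equiv.swap 0 1 * Equiv.swap 1 2 := by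
    decide
  have h1 : (1 : Equiv.Perm (Fin 3)).symm = 1 := by decide
  rw [sum_perm_fin_three]
  rcases fin_two_eq_zero_or_one (v 0) with h₀ | h₀ <;>
  rcases fin_two_eq_zero_or_one (v 1) with h₁' | h₁' <;>
  rcases fin_two_eq_zero_or_one (v 2) with h₂ | h₂ <;>
  rcases μ with _ | j <;> (try fin_cases j) <;>
  simp [h₀, h₁', h₂, Equiv.Perm.mul_apply, Equiv.swap_apply_of_ne_of_ne, Equiv.swap_apply_left,
    Equiv.swap_apply_right, Equiv.symm_swap, hc1, hc2, h1] <;> ring_nf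

/-- **The carrier equation.** For the Toda table, the crux right-hand side of species `0` at scale `n`
is `−lam^{4n/5} a_n − lamⁿ v_n² + lam^{n−1} v_{n−1}² − ε lamⁿ a_n v_n`
(`a = X 0`, `v = X 1`). -/
theorem toda_rhsF_zero :
    ∀ (ε lam : ℝ) (X : Fin 2 → ℤ → ℝ → ℝ) (n : ℤ) (t : ℝ),
      Summit.NavierStokesRegularity.NavierStokesRegularity.Theorems.CircuitPumpNegative.rhsF lam
      (fun (i₁ i₂ i₃ : Fin 2) (μ : Option (Fin 3)) => if μ = none then (if i₁ = 1 ∧ i₂ = 1 ∧ i₃ = 0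
      then (-1 : ℝ) else if i₁ = 1 ∧ i₂ = 0 ∧ i₃ = 1 then 1 / 2 else if i₁ = 0 ∧ i₂ = 1 ∧ i₃ = 1
      then 1 / 2 else if i₁ = 0 ∧ i₂ = 0 ∧ i₃ = 1 then ε else if i₁ = 0 ∧ i₂ = 1 ∧ i₃ = 0 then -ε /
      2 else if i₁ = 1 ∧ i₂ = 0 ∧ i₃ = 0 then -ε / 2 else 0) else if μ = some 2 then (if i₁ = 1 ∧
      i₂ = 1 ∧ i₃ = 0 then 1 else 0) else if μ = some 1 then (if i₁ = 1 ∧ i₂ = 0 ∧ i₃ = 1 then -1 /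
      2 else 0) else (if i₁ = 0 ∧ i₂ = 1 ∧ i₃ = 1 then -1 / 2 else 0)) X 0 n t = -(lam ^ ((4 / 5 :
      ℝ) * n)) * X 0 n t - lam ^ (n : ℝ) * X 1 n t ^ 2 + lam ^ ((n : ℝ) - 1) * X 1 (n - 1) t ^ 2 -
      ε * lam ^ (n : ℝ) * X 0 n t * X 1 n t := by
  intro ε lam X n t
  simp only [rhsF, Fin.sum_univ_two, Fintype.sum_option, Fin.sum_univ_three, Fin.isValue]
  simp
  ring

/-- **The bond equation.** For the Toda table, the crux right-hand side of species `1` at scale `n` is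
`−lam^{4n/5} v_n + lamⁿ v_n (a_n − a_{n+1}) + ε lamⁿ a_n²`. -/
theorem toda_rhsF_one :
    ∀ (ε lam : ℝ) (X : Fin 2 → ℤ → ℝ → ℝ) (n : ℤ) (t : ℝ),
      Summit.NavierStokesRegularity.NavierStokesRegularity.Theorems.CircuitPumpNegative.rhsF lam
      (fun (i₁ i₂ i₃ : Fin 2) (μ : Option (Fin 3)) => if μ = none then (if i₁ = 1 ∧ i₂ = 1 ∧ i₃ = 0
      then (-1 : ℝ) else if i₁ = 1 ∧ i₂ = 0 ∧ i₃ = 1 then 1 / 2 else if i₁ = 0 ∧ i₂ = 1 ∧ i₃ = 1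
      then 1 / 2 else if i₁ = 0 ∧ i₂ = 0 ∧ i₃ = 1 then ε else if i₁ = 0 ∧ i₂ = 1 ∧ i₃ = 0 then -ε /
      2 else if i₁ = 1 ∧ i₂ = 0 ∧ i₃ = 0 then -ε / 2 else 0) else if μ = some 2 then (if i₁ = 1 ∧
      i₂ = 1 ∧ i₃ = 0 then 1 else 0) else if μ = some 1 then (if i₁ = 1 ∧ i₂ = 0 ∧ i₃ = 1 then -1 /
      2 else 0) else (if i₁ = 0 ∧ i₂ = 1 ∧ i₃ = 1 then -1 / 2 else 0)) X 1 n t = -(lam ^ ((4 / 5 :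
      ℝ) * n)) * X 1 n t + lam ^ (n : ℝ) * X 1 n t * (X 0 n t - X 0 (n + 1) t) + ε * lam ^ (n : ℝ)
      * X 0 n t ^ 2 := by
  intro ε lam X n t
  simp only [rhsF, Fin.sum_univ_two, Fintype.sum_option, Fin.sum_univ_three, Fin.isValue]
  simp
  ring

end Summit.NavierStokesRegularity.NavierStokesRegularity.Theorems.PerpetualPumpCircuitPump
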